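import Literature.Geometry.Kaehler.MeromorphicGermResidue
import Literature.Geometry.Kaehler.RiemannSurfaceRiemannRochFirstForm
import Literature.Geometry.Kaehler.RiemannSurfaceFunctionField
import HarnessLib

/-!
# The analytic adeles (répartitions) of a compact Riemann surface and the adelic residue theorem
# `res_{A(0)}(F dG) = 0` on an algebraic curve (Tate 1968 §3, Thm. 3 and its Corollary; Miranda VI §2)

Layer `Literature/Geometry/Kaehler`, sequel of `MeromorphicGermResidue` (Tate's residue on the stalk of
meromorphic germs, the `E`-structure `inE_mulGerm`, `nearlyLE_orderGE`), of
`RiemannSurfaceLaurentTailDivisors` (the chart germ `germAt p`, `meromorphicClasses M = 𝓜(M)` as a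
`ℂ`-space, the Laurent tail divisors `𝒯[D](M) = laurentTailDivisors D`, `α_D`, `H¹(D) = H1 D`,
`L(D) = ker α_D`), `RiemannSurfaceH1Comparison` (`ker t^{D₁}_{D₂}` is finite-dimensional) and
`RiemannSurfaceRiemannRochFirstForm` (Proposition VI.2.7: `H¹(D)` is finite-dimensional on an algebraic
curve), and of `Literature/LinearAlgebra/TateResidue/TateResidue` (the abstract residue theorem
`res_eq_zero_of_quasiCompl`). J. Tate, *Residues of differentials on curves*, Ann. Sci. ÉNS (4) 1
(1968), §3, as printed (pp. 155–156):

> **THEOREM 3.** — Let `S` be any set of closed points `p`. Put `O(S) = ∩_{p ∈ S} O_p ⊂ K`. Then for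
> `ω ∈ Ω¹_{K/k}` we have `Σ_{p ∈ S} res_p(ω) = res^K_{O(S)}(ω)`, almost all terms of the sum being zero.
> **COROLLARY.** — We have `Σ_p res_p(ω) = 0` if the sum is taken over all closed points `p` of the
> complete curve `X`. The corollary follows from the theorem because, `X` being proper over `k`, the
> space `O(X) = H⁰(X, O_X)` is finite dimensional. Hence `res_{O(X)} = 0`, by (R₁), because
> `O(X) ∼ (0)`. To prove the theorem, let `A_S = Π_{p ∈ S} A_p`, and
> `V_S = {f = (f_p) | f_p ∈ K_p for all p ∈ S and f_p ∈ A_p for almost all p}`. We may assume `S`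
> non-empty. Then `K` may be regarded as a subspace of `V_S` by means of the diagonal embedding
> `f ↦ (f_p)`, where `f_p = f` for all `p ∈ S`. Considering the lattice of subspaces of `V_S` […] and
> using (R₅) we conclude that `res_{A_S} + res_K = res_{O(S)} + res_{K+A_S}`. But `res_K = 0` because
> `K` is a `K`-module, and `res_{K+A_S} = 0` because `V_S/(K + A_S)` is finite dimensional.

and R. Miranda, *Algebraic Curves and Riemann Surfaces*, GSM 5 (1995), Chapter VI §2 (the Laurent tail
divisors `𝒯[D](X)`, `α_D`, `H¹(D) = 𝒯[D](X)/image(α_D)`; Proposition 2.7: `H¹(D)` is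
finite-dimensional for an algebraic curve).

Here `X = M` is a compact connected Riemann surface, `K = 𝓜(M)` (realised as
`meromorphicClasses M ⊆ CofiniteGerm M`, acting through the chart germs `fnGerm F p` of its members
`F ∈ meromorphicFunctions M`), `K_p ⊇ A_p` is the stalk `meromorphicGerms (z_p p) ⊇ orderGE (z_p p) 0`
in the preferred chart `z_p`, and Tate's `V = V_X`, `A_X = A(0)`:

* §1 **`adeleSpace M`** (the analytic adeles / répartitions: families `γ = (γ_p)_p` of meromorphic
  germs, `γ_p ∈ A_p` for almost all `p`; a `ℂ`-subspace of `GermFamily M = Π_p Germ (𝓝[≠] (z_p p)) ℂ`),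
  `Adele M = ↥(adeleSpace M)`, **`adeleO D = A(D)`** (`ord_p γ_p ≥ −D(p)` for all `p`), `adeleO_mono`;
* §2 **`toTail D : Adele M →ₗ[ℂ] ↥(laurentTailDivisors D)`** (`V → 𝒯[D](M)`, componentwise truncation),
  `ker_toTail` (`= A(D)`: `V/A(D) ≅ 𝒯[D](M)`), `truncation_toTail`, **`nearlyLE_adeleO`**
  (`A(D₂) ≼ A(D₁)` for `D₁ ≤ D₂`, the quotient embedding in `ker t^{D₁}_{D₂}`), `nearlyLE_adeleO'`
  (any two);
* §3 **`diag : ↥(meromorphicClasses M) →ₗ[ℂ] Adele M`** (the diagonal embedding `f ↦ (f_p)`),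
  `diag_injective`, **`principalAdeles M`** (`= range diag`), `toTail_diag` (`= α_D`),
  `diag_mem_adeleO_iff` (`diag f ∈ A(D) ↔ f ∈ L(D)`), **`finiteDimensional_adeleO_inf_principalAdeles`**
  (`A(D) ∩ K ≅ L(D)` is finite-dimensional — «`O(X) ∼ (0)`»), `toH1`, `ker_toH1`
  (`= A(D) + K`: `V/(A(D) + K) ↪ H¹(D)`), **`nearlyLE_top_adeleO_sup_principalAdeles`**
  (`V/(K + A(D))` is finite-dimensional on an algebraic curve — Proposition VI.2.7);
* §4 **`Adele.mulFn hF`** (multiplication by `F ∈ 𝓜(M)`, componentwise by `fnGerm F p`), `mulFn_apply`,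
  `commute_mulFn`, `exists_fnGerm_mem_orderGE`, `map_mulFn_adeleO_le`, **`inE_adeleO_mulFn`**
  («`f A_S ≺ A_S`»), `germAt_mulCofinite`, **`map_mulFn_principalAdeles_le`** («`K` is a `K`-module»);
* §5 **`adelicRes F G = res_{A(0)}(F dG)`** and **THE ADELIC RESIDUE THEOREM `adelicRes_eq_zero`**
  (`[IsAlgebraicCurve M]`): `res^{V}_{A(0)}(μ_F dμ_G) = 0` for all `F, G ∈ 𝓜(M)`, by Tate's
  `res_eq_zero_of_quasiCompl` with `B = K`.

Everything is proved; the definitions (`adeleSpace`, `Adele`, `adeleO`, `toTailAmbient`, `toTail`,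
`diag`, `principalAdeles`, `toH1`, `fnFamily`, `Adele.mulFn`, `adelicRes`) have bodies; no named facts,
no instances. NOT here: locality `res_{A(0)} = Σ_p res_p` (Tate's Thm. 3 proper) and the residue
theorem for meromorphic `1`-forms (the sequel `RiemannSurfaceResidueTheorem`); Weil differentials /
Serre duality (`V/(A(D)+K)` IS `H¹(D)`, only the injection is used here).

## References

* J. Tate, *Residues of differentials on curves*, Ann. Sci. École Norm. Sup. (4) 1 (1968), 149–159,
  §3 Thm. 3 and Corollary (pp. 155–156). [Tate1968]
* R. Miranda, *Algebraic Curves and Riemann Surfaces*, GSM 5, AMS (1995), Chapter VI §2 (Definition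
  2.1, `α_D`, `H¹(D)`), Proposition 2.7. [Miranda1995]
-/

noncomputable section

open scoped Manifold ContDiff Topology OnePoint
open Filter Function Set
open Literature.LinearAlgebra.TateResidue Literature.LinearAlgebra.TateResidue.Tate

namespace Literature.Geometry.Kaehler

namespace RiemannSurface

open MeromorphicGerm

variable {M : Type*} [TopologicalSpace M] [ChartedSpace ℂ M]

/-! ### §1 The adele space `V_M` and the subspaces `A(D)` -/

section Space

variable (M) in
/-- The ambient product `Π_p Germ (𝓝[≠] (z_p p)) ℂ` of all germ families (Tate's `Π_p K_p` before the
restriction). [cite: Tate1968, §3, Thm. 3 (proof: `V_S`)] -/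
abbrev GermFamily : Type _ := Π p : M, Germ (𝓝[≠] (chartAt ℂ p p)) ℂ

variable (M) in
/-- **The analytic adele space `V_M`** (répartitions) of a Riemann surface: the families `γ = (γ_p)` of
MEROMORPHIC germs `γ_p ∈ K_p` (in the preferred chart at `p`) with `γ_p ∈ A_p = orderGE 0` for all but
finitely many `p` — «`V_S = {f = (f_p) | f_p ∈ K_p for all p ∈ S and f_p ∈ A_p for almost all p}`» with
`S = X`. [cite: Tate1968, §3, Thm. 3 (proof)] -/
def adeleSpace : Submodule ℂ (GermFamily M) where
  carrier := {γ | (∀ p, γ p ∈ meromorphicGerms (chartAt ℂ p p)) ∧ {p | γ p ∉ orderGE (chartAt ℂ p p) 0}.Finite}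
  zero_mem' := ⟨fun p ↦ Submodule.zero_mem _, by simp⟩
  add_mem' := by
    rintro γ δ ⟨hγ, hγf⟩ ⟨hδ, hδf⟩
    refine ⟨fun p ↦ Submodule.add_mem _ (hγ p) (hδ p), (hγf.union hδf).subset fun p hp ↦ ?_⟩
    by_contra h
    simp only [mem_union, mem_setOf_eq, not_or, not_not] at h
    exact hp (Submodule.add_mem _ h.1 h.2)
  smul_mem' := by
    rintro c γ ⟨hγ, hγf⟩
    refine ⟨fun p ↦ Submodule.smul_mem _ c (hγ p), hγf.subset fun p hp ↦ ?_⟩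
    by_contra h
    simp only [mem_setOf_eq, not_not] at h
    exact hp (Submodule.smul_mem _ c h)

variable (M) in
/-- The type of analytic adeles `V_M` (the subspace `adeleSpace M` as a `ℂ`-vector space).
[cite: Tate1968, §3, Thm. 3 (proof)] -/
abbrev Adele : Type _ := ↥(adeleSpace M)

/-- Membership in `adeleSpace` (unfolding). [cite: Tate1968, §3, Thm. 3 (proof)] -/
theorem mem_adeleSpace_iff {γ : GermFamily M} :
    γ ∈ adeleSpace M ↔ (∀ p, γ p ∈ meromorphicGerms (chartAt ℂ p p)) ∧
      {p | γ p ∉ orderGE (chartAt ℂ p p) 0}.Finite := Iff.rfl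

/-- The components of an adele are meromorphic germs. [cite: Tate1968, §3, Thm. 3 (proof)] -/
theorem Adele.apply_mem (α : Adele M) (p : M) : (α : GermFamily M) p ∈ meromorphicGerms (chartAt ℂ p p) :=
  α.2.1 p

/-- Almost all components of an adele lie in `A_p`. [cite: Tate1968, §3, Thm. 3 (proof)] -/
theorem Adele.finite_setOf_not_mem (α : Adele M) : {p | (α : GermFamily M) p ∉ orderGE (chartAt ℂ p p) 0}.Finite :=
  α.2.2

/-- **`A(D) ⊆ V_M`**: the adeles with `ord_p(γ_p) ≥ −D(p)` at every `p` (`A(0) = A_X = Π_p A_p`; for a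
divisor `D` the kernel of `V → 𝒯[D](M)`). [cite: Tate1968, §3, Thm. 3 (proof: `A_S = Π A_p`); Miranda1995, Chapter VI §2 Definition 2.1] -/
def adeleO (D : M →₀ ℤ) : Submodule ℂ (Adele M) where
  carrier := {α | ∀ p, (α : GermFamily M) p ∈ orderGE (chartAt ℂ p p) (-D p)}
  zero_mem' p := Submodule.zero_mem _
  add_mem' {α β} hα hβ p := by
    rw [Submodule.coe_add, Pi.add_apply]; exact Submodule.add_mem _ (hα p) (hβ p)
  smul_mem' c α hα p := by
    rw [Submodule.coe_smul, Pi.smul_apply]; exact Submodule.smul_mem _ c (hα p)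

/-- Membership in `A(D)` (unfolding). [cite: Tate1968, §3, Thm. 3 (proof)] -/
theorem mem_adeleO_iff {D : M →₀ ℤ} {α : Adele M} :
    α ∈ adeleO D ↔ ∀ p, (α : GermFamily M) p ∈ orderGE (chartAt ℂ p p) (-D p) := Iff.rfl

/-- `A(D₁) ⊆ A(D₂)` for `D₁ ≤ D₂`. [cite: Tate1968, §3; Miranda1995, Chapter VI §2] -/
theorem adeleO_mono {D₁ D₂ : M →₀ ℤ} (h : D₁ ≤ D₂) : adeleO D₁ ≤ adeleO D₂ :=
  fun _ hα p ↦ orderGE_antitone (neg_le_neg (h p)) (hα p)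

/-- Build an adele from a family of meromorphic germs, almost all in `A_p`. [cite: Tate1968, §3, Thm. 3 (proof)] -/
def Adele.mk (γ : GermFamily M) (h₁ : ∀ p, γ p ∈ meromorphicGerms (chartAt ℂ p p))
    (h₂ : {p | γ p ∉ orderGE (chartAt ℂ p p) 0}.Finite) : Adele M := ⟨γ, h₁, h₂⟩

/-- Components of `Adele.mk`. [cite: Tate1968, §3, Thm. 3 (proof)] -/
@[simp]
theorem Adele.coe_mk (γ : GermFamily M) (h₁ h₂) : ((Adele.mk γ h₁ h₂ : Adele M) : GermFamily M) = γ := rfl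

end Space

/-! ### §2 `V → 𝒯[D](M)` and `A(D₂) ≼ A(D₁)` -/

section Tail

/-- Componentwise truncation `V → Π_p (Germ ⧸ orderGE (−D p))`. [cite: Miranda1995, Chapter VI §2 (the truncation maps); Tate1968, §3] -/
def toTailAmbient (D : M →₀ ℤ) : Adele M →ₗ[ℂ] LaurentTailAmbient D where
  toFun α p := (orderGE (chartAt ℂ p p) (-D p)).mkQ ((α : GermFamily M) p)
  map_add' α β := by funext p; simp
  map_smul' c α := by funext p; simp

/-- Components of `toTailAmbient`. [cite: Miranda1995, Chapter VI §2] -/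
@[simp]
theorem toTailAmbient_apply (D : M →₀ ℤ) (α : Adele M) (p : M) :
    toTailAmbient D α p = (orderGE (chartAt ℂ p p) (-D p)).mkQ ((α : GermFamily M) p) := rfl

/-- `toTailAmbient` lands in the Laurent tail divisors `𝒯[D](M)` (meromorphic components, finitely many
non-zero). [cite: Miranda1995, Chapter VI Definition 2.1] -/
theorem toTailAmbient_mem (D : M →₀ ℤ) (α : Adele M) : toTailAmbient D α ∈ laurentTailDivisors D := by
  refine ⟨fun p ↦ ⟨_, α.apply_mem p, rfl⟩, (α.finite_setOf_not_mem.union D.support.finite_toSet).subset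
    fun p hp ↦ ?_⟩
  by_contra h
  simp only [mem_union, mem_setOf_eq, Finset.mem_coe, Finsupp.mem_support_iff, not_or, not_not] at h
  refine hp ?_
  rw [toTailAmbient_apply, Submodule.mkQ_apply, Submodule.Quotient.mk_eq_zero, h.2, neg_zero]
  exact h.1

/-- **`V_M → 𝒯[D](M)`**, componentwise truncation of an adele below degree `−D(p)` (onto, with kernel
`A(D)`: `V/A(D) ≅ 𝒯[D](M)`). [cite: Miranda1995, Chapter VI §2; Tate1968, §3] -/
def toTail (D : M →₀ ℤ) : Adele M →ₗ[ℂ] ↥(laurentTailDivisors D) :=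
  (toTailAmbient D).codRestrict _ (toTailAmbient_mem D)

/-- Components of `toTail`. [cite: Miranda1995, Chapter VI §2] -/
@[simp]
theorem toTail_apply (D : M →₀ ℤ) (α : Adele M) (p : M) :
    (toTail D α : LaurentTailAmbient D) p = (orderGE (chartAt ℂ p p) (-D p)).mkQ ((α : GermFamily M) p) := rfl

/-- **`ker (V → 𝒯[D](M)) = A(D)`.** [cite: Miranda1995, Chapter VI §2; Tate1968, §3] -/
theorem ker_toTail (D : M →₀ ℤ) : LinearMap.ker (toTail D) = adeleO D := by
  ext α
  rw [LinearMap.mem_ker, mem_adeleO_iff, ← Subtype.coe_inj, funext_iff]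
  refine forall_congr' fun p ↦ ?_
  rw [toTail_apply, Submodule.coe_zero, Pi.zero_apply, Submodule.mkQ_apply, Submodule.Quotient.mk_eq_zero]

/-- `toTail D α = 0 ↔ α ∈ A(D)`. [cite: Miranda1995, Chapter VI §2] -/
theorem toTail_eq_zero_iff (D : M →₀ ℤ) (α : Adele M) : toTail D α = 0 ↔ α ∈ adeleO D := by
  rw [← LinearMap.mem_ker, ker_toTail]

/-- `t^{D₁}_{D₂} ∘ (V → 𝒯[D₁]) = (V → 𝒯[D₂])`. [cite: Miranda1995, Chapter VI §2 (the truncation maps)] -/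
theorem truncation_toTail {D₁ D₂ : M →₀ ℤ} (h : D₁ ≤ D₂) (α : Adele M) :
    truncation h (toTail D₁ α) = toTail D₂ α := by
  apply Subtype.ext
  funext p
  rw [truncation_apply, toTail_apply, toTail_apply]
  rfl

/-- **`A(D₂) ≼ A(D₁)` for `D₁ ≤ D₂`**: `A(D₂)/A(D₁)` embeds in `ker t^{D₁}_{D₂}`, which is
finite-dimensional (of dimension `deg D₂ − deg D₁`). [cite: Tate1968, §3 («`f A_p ≺ A_p`»); Miranda1995, Chapter VI §2 («`dim ker(t) = deg(D₂) − deg(D₁)`»)] -/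
theorem nearlyLE_adeleO {D₁ D₂ : M →₀ ℤ} (h : D₁ ≤ D₂) : NearlyLE (adeleO (M := M) D₂) (adeleO D₁) := by
  let φ : ↥(adeleO (M := M) D₂) →ₗ[ℂ] ↥(LinearMap.ker (truncation h)) :=
    LinearMap.codRestrict _ ((toTail D₁).comp (adeleO D₂).subtype) fun α ↦ by
      rw [LinearMap.mem_ker, LinearMap.comp_apply, truncation_toTail, Submodule.subtype_apply,
        toTail_eq_zero_iff]
      exact α.2
  -- (through `ker t ≃ KerTailFamily`, a product of finitely many finite-dimensional spaces; the
  -- instance arguments are passed by unification)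
  refine @NearlyLE.of_linearMap_ker_le ℂ (Adele M) _ _ _ (adeleO D₁) (adeleO D₂) (KerTailFamily D₁ D₂)
    _ _ _ ((kerTruncationEquiv h).toLinearMap.comp φ) fun α hα ↦ ?_
  rw [LinearMap.comp_apply, LinearEquiv.coe_toLinearMap, LinearEquiv.map_eq_zero_iff] at hα
  rw [← toTail_eq_zero_iff]
  simpa [φ] using congrArg Subtype.val hα

/-- `A(D) ≼ A(D′)` for ANY two divisors (through `A(D ⊔ D′)`). [cite: Tate1968, §3 («`f A_p ≺ A_p`»)] -/
theorem nearlyLE_adeleO' (D D' : M →₀ ℤ) : NearlyLE (adeleO (M := M) D) (adeleO D') :=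
  (nearlyLE_adeleO (le_sup_right : D' ≤ D ⊔ D')).mono_left (adeleO_mono le_sup_left)

end Tail

/-! ### §3 The diagonal `K = 𝓜(M) ↪ V_M`, `A(D) ∩ K = L(D)` and `V/(A(D) + K) ↪ H¹(D)` -/

section Diagonal

variable [IsManifold 𝓘(ℂ, ℂ) ω M] [CompactSpace M] [T2Space M] [PreconnectedSpace M] [Nonempty M]

/-- `[F] ∈ 𝓜(M)` has chart germs in `A_p` off the poles of `F`. [cite: Miranda1995, Chapter VI §2 («if `D(p) = 0`, then … zero if and only if `f` is holomorphic at `p`»)] -/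
theorem germAt_mem_orderGE_zero_of_ne_infty {F : M → OnePoint ℂ} (hF : F ∈ meromorphicFunctions M) {p : M}
    (hp : F p ≠ (∞ : OnePoint ℂ)) : germAt p (toGerm F) ∈ orderGE (chartAt ℂ p p) 0 := by
  have h := alphaAt_toGerm_eq_zero_of_ne_infty (0 : M →₀ ℤ) p hF hp rfl
  rw [alphaAt_eq_zero_iff] at h
  exact ⟨germAt_mem_meromorphicGerms (toGerm_mem_meromorphicClasses hF) p, by simpa using h⟩

/-- The chart germs of `v ∈ 𝓜(M)` lie in `A_p` for almost all `p` (off the poles). [cite: Tate1968, §3 (the diagonal embedding); Miranda1995, Chapter VI Definition 2.1 («a finite formal sum»)] -/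
theorem finite_setOf_germAt_not_mem (v : ↥(meromorphicClasses M)) :
    {p | germAt p (v : CofiniteGerm M) ∉ orderGE (chartAt ℂ p p) 0}.Finite := by
  refine (finite_setOf_alphaAt_ne_zero (0 : M →₀ ℤ) v).subset fun p hp ↦ ?_
  simp only [mem_setOf_eq] at hp ⊢
  rw [Ne, alphaAt_eq_zero_iff]
  simp only [Finsupp.coe_zero, Pi.zero_apply, neg_zero, WithTop.coe_zero]
  exact fun h ↦ hp ⟨germAt_mem_meromorphicGerms v.2 p, by exact_mod_cast h⟩

/-- **The diagonal embedding `K = 𝓜(M) ↪ V_M`**, `f ↦ (f_p)_p` (the chart germs of `f`).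
[cite: Tate1968, §3, Thm. 3 (proof: «`K` may be regarded as a subspace of `V_S` by means of the diagonal embedding»)] -/
def diag : ↥(meromorphicClasses M) →ₗ[ℂ] Adele M where
  toFun v := Adele.mk (fun p ↦ germAt p (v : CofiniteGerm M)) (germAt_mem_meromorphicGerms v.2)
    (finite_setOf_germAt_not_mem v)
  map_add' v w := by apply Subtype.ext; funext p; simp
  map_smul' c v := by apply Subtype.ext; funext p; simp

/-- Components of the diagonal. [cite: Tate1968, §3, Thm. 3 (proof)] -/
@[simp]
theorem diag_apply (v : ↥(meromorphicClasses M)) (p : M) :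
    ((diag v : Adele M) : GermFamily M) p = germAt p (v : CofiniteGerm M) := rfl

/-- `(V → 𝒯[D]) ∘ diag = α_D`. [cite: Miranda1995, Chapter VI §2 (the map `α_D`)] -/
theorem toTail_diag (D : M →₀ ℤ) (v : ↥(meromorphicClasses M)) : toTail D (diag v) = alpha D v := by
  apply Subtype.ext
  funext p
  rw [toTail_apply, diag_apply, alpha_apply, alphaAt_apply]

/-- **`diag f ∈ A(D) ↔ f ∈ L(D)`** (`A(D) ∩ K = L(D)`; for `D = 0`: «`O(X) = H⁰(X, O_X)`»).
[cite: Tate1968, §3, Corollary (proof); Miranda1995, Chapter VI §2 («`L(D) = ker(α_D)`»)] -/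
theorem diag_mem_adeleO_iff (D : M →₀ ℤ) (v : ↥(meromorphicClasses M)) :
    diag v ∈ adeleO D ↔ (v : CofiniteGerm M) ∈ riemannRochSubmodule D := by
  rw [← toTail_eq_zero_iff, toTail_diag, alpha_eq_zero_iff_mem_riemannRochSubmodule]

/-- The diagonal embedding is injective (a meromorphic function is determined by its chart germ at any
point: `α_D` with `D` large detects it; here via `L(D)` for very negative `D`). [cite: Tate1968, §3, Thm. 3 (proof)] -/
theorem diag_injective : Function.Injective (diag (M := M)) := by
  intro v w h
  -- `v - w` has all germs `0`, so it lies in every `L(D)`; take `D` with `L(D) = 0`.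
  have hker : ∀ D : M →₀ ℤ, ((v - w : ↥(meromorphicClasses M)) : CofiniteGerm M) ∈ riemannRochSubmodule D := by
    intro D
    rw [← diag_mem_adeleO_iff, map_sub, h, sub_self]
    exact Submodule.zero_mem _
  obtain ⟨p⟩ := ‹Nonempty M›
  have hneg : Finsupp.degree (-Finsupp.single p (1 : ℤ)) < 0 := by
    rw [map_neg, Finsupp.degree_single]; norm_num
  have h0 := hker (-Finsupp.single p 1)
  rw [riemannRochSubmodule_eq_bot_of_degree_neg hneg, Submodule.mem_bot, Submodule.coe_sub, sub_eq_zero] at h0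
  exact Subtype.ext h0

variable (M) in
/-- **The principal adeles `K ⊆ V_M`**: the image of the diagonal. [cite: Tate1968, §3, Thm. 3 (proof)] -/
def principalAdeles : Submodule ℂ (Adele M) := LinearMap.range (diag (M := M))

/-- Membership in the principal adeles. [cite: Tate1968, §3, Thm. 3 (proof)] -/
theorem mem_principalAdeles_iff {α : Adele M} : α ∈ principalAdeles M ↔ ∃ v, diag v = α := LinearMap.mem_range

/-- **`A(D) ∩ K ≅ L(D)` is finite-dimensional** («`O(X) = H⁰(X, O_X)` is finite dimensional … `O(X) ∼ (0)`»).
[cite: Tate1968, §3, Corollary (proof); Miranda1995, Chapter V §3 («`L(D)` is finite-dimensional»)] -/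
theorem finiteDimensional_adeleO_inf_principalAdeles (D : M →₀ ℤ) :
    FiniteDimensional ℂ ↥(adeleO D ⊓ principalAdeles M) := by
  set L' : Submodule ℂ ↥(meromorphicClasses M) :=
    Submodule.comap (meromorphicClasses M).subtype (riemannRochSubmodule D) with hL'
  haveI : FiniteDimensional ℂ L' := LinearEquiv.finiteDimensional
    (Submodule.comapSubtypeEquivOfLe (riemannRochSubmodule_le_meromorphicClasses D)).symm
  refine Submodule.finiteDimensional_of_le (S₂ := L'.map diag) ?_
  rintro α ⟨hα, hαK⟩
  obtain ⟨v, rfl⟩ := mem_principalAdeles_iff.1 hαK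
  exact ⟨v, (diag_mem_adeleO_iff D v).1 hα, rfl⟩

/-- `V_M → 𝒯[D](M) → (ambient) ⧸ image(α_D)`: the adele class in (the ambient of) `H¹(D)`.
[cite: Miranda1995, Chapter VI §2 («`H¹(D) := coker(α_D)`»); Tate1968, §3 («`V_S/(K + A_S)`»)] -/
def toH1 (D : M →₀ ℤ) : Adele M →ₗ[ℂ] (LaurentTailAmbient D ⧸ LinearMap.range (alphaAmbient D)) :=
  (LinearMap.range (alphaAmbient D)).mkQ.comp (toTailAmbient D)

/-- `toH1` lands in `H¹(D)`. [cite: Miranda1995, Chapter VI §2] -/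
theorem toH1_mem (D : M →₀ ℤ) (α : Adele M) : toH1 D α ∈ H1 D :=
  mkQ_mem_H1 D (toTailAmbient_mem D α)

/-- **`ker (V → H¹(D)) = A(D) + K`**: an adele maps to `0` in `H¹(D)` iff it is a principal adele plus
an element of `A(D)` (so `V/(A(D) + K) ↪ H¹(D)`; in fact `≅`). [cite: Tate1968, §3, Thm. 3 (proof: «`V_S/(K + A_S)` is finite dimensional»); Miranda1995, Chapter VI §2] -/
theorem toH1_eq_zero_iff (D : M →₀ ℤ) (α : Adele M) : toH1 D α = 0 ↔ α ∈ adeleO D ⊔ principalAdeles M := by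
  rw [toH1, LinearMap.comp_apply, mkQ_eq_zero_iff]
  constructor
  · rintro ⟨v, hv⟩
    rw [Submodule.mem_sup]
    refine ⟨α - diag v, ?_, diag v, ⟨v, rfl⟩, sub_add_cancel _ _⟩
    rw [mem_adeleO_iff]
    intro p
    have hp := congrFun hv p
    rw [alphaAmbient_apply, alphaAt_apply, toTailAmbient_apply, Submodule.mkQ_apply, Submodule.mkQ_apply,
      Submodule.Quotient.eq] at hp
    rw [Submodule.coe_sub, Pi.sub_apply, diag_apply]
    have := (orderGE (chartAt ℂ p p) (-D p)).neg_mem hp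
    rwa [neg_sub] at this
  · intro h
    obtain ⟨β, hβ, _, ⟨v, rfl⟩, rfl⟩ := Submodule.mem_sup.1 h
    refine ⟨v, funext fun p ↦ ?_⟩
    rw [alphaAmbient_apply, alphaAt_apply, toTailAmbient_apply, Submodule.mkQ_apply, Submodule.mkQ_apply,
      Submodule.Quotient.eq, Submodule.coe_add, Pi.add_apply, diag_apply]
    have := (orderGE (chartAt ℂ p p) (-D p)).neg_mem (hβ p)
    simpa using this

/-- **`V ≼ A(D) + K` on an algebraic curve**: `V_M/(A(D) + K)` embeds in `H¹(D)`, finite-dimensional by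
Proposition VI.2.7 («`res_{K+A_S} = 0` because `V_S/(K + A_S)` is finite dimensional»).
[cite: Tate1968, §3, Thm. 3 (proof); Miranda1995, Chapter VI Proposition 2.7] -/
theorem nearlyLE_top_adeleO_sup_principalAdeles [IsAlgebraicCurve M] (D : M →₀ ℤ) :
    NearlyLE ⊤ (adeleO D ⊔ principalAdeles M) := by
  let φ : ↥(⊤ : Submodule ℂ (Adele M)) →ₗ[ℂ] ↥(H1 D) :=
    LinearMap.codRestrict _ ((toH1 D).comp (⊤ : Submodule ℂ (Adele M)).subtype) fun α ↦ toH1_mem D _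
  refine NearlyLE.of_linearMap_ker_le φ fun α hα ↦ ?_
  rw [← toH1_eq_zero_iff]
  simpa [φ] using congrArg Subtype.val hα

end Diagonal

/-! ### §4 Multiplication by `F ∈ 𝓜(M)` on `V_M`: `μ_F ∈ E(A(D))` and `μ_F K ⊆ K` -/

section Mul

variable [IsManifold 𝓘(ℂ, ℂ) ω M] [CompactSpace M] [T2Space M] [PreconnectedSpace M] [Nonempty M]
  {F G : M → OnePoint ℂ}

/-- The family of chart germs `(φ_p(F))_p` of a meromorphic function is an adele (it is `diag [F]`).
[cite: Tate1968, §3, Thm. 3 (proof: the diagonal embedding)] -/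
theorem fnGerm_mem_adeleSpace (hF : F ∈ meromorphicFunctions M) : (fun p ↦ fnGerm F p) ∈ adeleSpace M :=
  (diag ⟨toGerm F, toGerm_mem_meromorphicClasses hF⟩).2

/-- `diag [F] = (φ_p(F))_p`. [cite: Tate1968, §3, Thm. 3 (proof)] -/
theorem diag_toGerm_apply (hF : F ∈ meromorphicFunctions M) (p : M) :
    ((diag ⟨toGerm F, toGerm_mem_meromorphicClasses hF⟩ : Adele M) : GermFamily M) p = fnGerm F p := rfl

/-- **Multiplication by `F ∈ 𝓜(M)` on the adeles**: `(μ_F γ)_p = φ_p(F) · γ_p` (Tate's action of `K`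
on `V_S`). [cite: Tate1968, §3, Thm. 3 (proof: «`K_p`-module», «`K`-module»)] -/
def Adele.mulFn (hF : F ∈ meromorphicFunctions M) : Adele M →ₗ[ℂ] Adele M where
  toFun α := Adele.mk (fun p ↦ fnGerm F p * (α : GermFamily M) p)
    (fun p ↦ mul_mem_meromorphicGerms ((fnGerm_mem_adeleSpace hF).1 p) (α.apply_mem p))
    (((fnGerm_mem_adeleSpace hF).2.union α.finite_setOf_not_mem).subset fun p hp ↦ by
      by_contra h
      simp only [mem_union, mem_setOf_eq, not_or, not_not] at h
      exact hp (by simpa using mul_mem_orderGE h.1 h.2))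
  map_add' α β := by
    apply Subtype.ext; funext p
    simp only [Adele.coe_mk, Submodule.coe_add, Pi.add_apply, mul_add]
  map_smul' c α := by
    apply Subtype.ext; funext p
    simp only [Adele.coe_mk, Submodule.coe_smul, Pi.smul_apply, RingHom.id_apply, mul_smul_comm_germ]

/-- Components of `μ_F α`. [cite: Tate1968, §3, Thm. 3 (proof)] -/
@[simp]
theorem Adele.mulFn_apply (hF : F ∈ meromorphicFunctions M) (α : Adele M) (p : M) :
    ((Adele.mulFn hF α : Adele M) : GermFamily M) p = fnGerm F p * (α : GermFamily M) p := rfl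

/-- Multiplications commute. [cite: Tate1968, §3 («`K` a commutative `k`-algebra»)] -/
theorem Adele.commute_mulFn (hF : F ∈ meromorphicFunctions M) (hG : G ∈ meromorphicFunctions M) :
    Commute (Adele.mulFn hF) (Adele.mulFn hG) := by
  ext α p
  simp only [Module.End.mul_apply, Adele.mulFn_apply, mul_left_comm]

omit [T2Space M] [Nonempty M] in
/-- **A pole bound**: the chart germs of `F ∈ 𝓜(M)` lie in `orderGE (−E(p))` for some divisor `E`
(`E = −div F` for a non-constant `F`; `E = 0` for a constant). [cite: Tate1968, §3 («`f A_p = tⁿ A_p` for some `n`»)] -/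
theorem exists_fnGerm_mem_orderGE (hF : F ∈ meromorphicFunctions M) :
    ∃ E : M →₀ ℤ, ∀ p, fnGerm F p ∈ orderGE (chartAt ℂ p p) (-E p) := by
  by_cases hne : ∃ a b, F a ≠ F b
  · refine ⟨-divisor F, fun p ↦ ?_⟩
    rw [Finsupp.coe_neg, Pi.neg_apply, neg_neg, divisor_apply hF.1 hne]
    exact fnGerm_mem_orderGE hF.1 hne p
  · obtain ⟨c, rfl⟩ := eq_const_of_not_exists_ne hF hne
    refine ⟨0, fun p ↦ ?_⟩
    rw [fnGerm_const, Finsupp.coe_zero, Pi.zero_apply, neg_zero, coe_mem_orderGE_iff]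
    classical
    refine ⟨MeromorphicAt.const c _, ?_⟩
    rw [meromorphicOrderAt_const]
    split_ifs <;> simp

/-- `μ_F A(D) ⊆ A(D + E)` for a pole bound `E` of `F`. [cite: Tate1968, §3 («`f A_p = tⁿ A_p`»)] -/
theorem map_mulFn_adeleO_le (hF : F ∈ meromorphicFunctions M) {E : M →₀ ℤ}
    (hE : ∀ p, fnGerm F p ∈ orderGE (chartAt ℂ p p) (-E p)) (D : M →₀ ℤ) :
    (adeleO D).map (Adele.mulFn hF) ≤ adeleO (D + E) := by
  rintro _ ⟨α, hα, rfl⟩ p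
  rw [Adele.mulFn_apply, Finsupp.coe_add, Pi.add_apply, neg_add, add_comm]
  exact mul_mem_orderGE (hE p) (hα p)

/-- **`μ_F ∈ E(A(D))`**: multiplication by a global meromorphic function is «not much bigger» on every
`A(D)` («`f A_S ≺ A_S`»). [cite: Tate1968, §3, Thm. 3 (proof)] -/
theorem inE_adeleO_mulFn (D : M →₀ ℤ) (hF : F ∈ meromorphicFunctions M) : InE (adeleO D) (Adele.mulFn hF) := by
  obtain ⟨E, hE⟩ := exists_fnGerm_mem_orderGE hF
  exact (nearlyLE_adeleO' (D + E) D).mono_left (map_mulFn_adeleO_le hF hE D)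

/-- **`μ_F K ⊆ K`**: the principal adeles are stable under multiplication by `F ∈ 𝓜(M)`
(`μ_F (diag [G]) = diag [F·G]`; «`res_K = 0` because `K` is a `K`-module»). [cite: Tate1968, §3, Thm. 3 (proof)] -/
theorem map_mulFn_principalAdeles_le (hF : F ∈ meromorphicFunctions M) :
    (principalAdeles M).map (Adele.mulFn hF) ≤ principalAdeles M := by
  rintro _ ⟨α, hα, rfl⟩
  obtain ⟨⟨v, hv⟩, rfl⟩ := mem_principalAdeles_iff.1 hα
  obtain ⟨G, hG, rfl⟩ := hv
  refine mem_principalAdeles_iff.2 ⟨⟨toGerm (mul F G), toGerm_mem_meromorphicClasses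
    (mul_mem_meromorphicFunctions' hF hG)⟩, Subtype.ext (funext fun p ↦ ?_)⟩
  rw [diag_apply, Adele.mulFn_apply, diag_apply]
  change germAt p (toGerm (mul F G)) = fnGerm F p * germAt p (toGerm G)
  rw [toGerm_mul hF.1 hF.2 hG.1 hG.2, germAt_mulCofinite F p]

end Mul

/-! ### §5 The adelic residue theorem `res_{A(0)}(F dG) = 0` -/

section Residue

variable [IsManifold 𝓘(ℂ, ℂ) ω M] [CompactSpace M] [T2Space M] [PreconnectedSpace M] [Nonempty M]
  {F G : M → OnePoint ℂ}

/-- **The global (adelic) residue `res_{A(0)}(F dG)`**: Tate's abstract residue for `V = V_M`,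
`A = A(0) = Π_p A_p` and the commuting operators `μ_F`, `μ_G`. [cite: Tate1968, §3, Thm. 3 (with `S = X`)] -/
def adelicRes (hF : F ∈ meromorphicFunctions M) (hG : G ∈ meromorphicFunctions M) : ℂ :=
  res (adeleO (0 : M →₀ ℤ)) (Adele.mulFn hF) (Adele.mulFn hG)

/-- Unfolding `adelicRes`. [cite: Tate1968, §3, Thm. 3] -/
theorem adelicRes_def (hF : F ∈ meromorphicFunctions M) (hG : G ∈ meromorphicFunctions M) :
    adelicRes hF hG = res (adeleO (0 : M →₀ ℤ)) (Adele.mulFn hF) (Adele.mulFn hG) := rfl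

/-- **The adelic residue theorem on an algebraic curve: `res_{A(0)}(F dG) = 0`** for all `F, G ∈ 𝓜(M)`
(Tate's abstract residue theorem with `B = K`: `K` is `μ`-invariant, `A(0) ∩ K = L(0)` is
finite-dimensional and `V/(A(0) + K) ↪ H¹(0)` is finite-dimensional by Proposition VI.2.7).
[cite: Tate1968, §3, Thm. 3, Corollary; Miranda1995, Chapter VI Proposition 2.7] -/
theorem adelicRes_eq_zero [IsAlgebraicCurve M] (hF : F ∈ meromorphicFunctions M) (hG : G ∈ meromorphicFunctions M) :
    adelicRes hF hG = 0 := by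
  haveI := finiteDimensional_adeleO_inf_principalAdeles (M := M) 0
  exact res_eq_zero_of_quasiCompl (inE_adeleO_mulFn 0 hF) (inE_adeleO_mulFn 0 hG) (Adele.commute_mulFn hF hG)
    (map_mulFn_principalAdeles_le hF) (map_mulFn_principalAdeles_le hG)
    (nearlyLE_top_adeleO_sup_principalAdeles 0)

end Residue

end RiemannSurface

end Literature.Geometry.Kaehler

end
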